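import Summits.QuantumFields.BalabanUV.T4Continuum.Support.NE3HessContinuity
import Summits.QuantumFields.BalabanUV.T4Continuum.Support.AveragingDeficitPlaqDeriv

/-!
# T⁴ programme, node NE3 — STABILITY OF THE DRESSED CURL AND OF THE DIAGONAL HESSIAN LOWER BOUND ALONG THE
# EXPONENTIAL SEGMENT `V e^{tX}` (leaf L6(b) of road P3 in the form its (E2) uses; first-order objects only)

First generation of the NE3 prover lineage P3 of the cell `pub-balaban` (unit `b2b-balaban-t4-ne3-p3`; co-owner #3 of
row NE3), fifth file of the `Support/NE3Hess*` family (`NE3HessForm` → `NE3HessBounds` → `NE3HessContinuity` →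
this).  Road P3 (`t4/skeletons/NE3-t4-ne3-p3.md` §1 (E2)) needs the tangent coercivity of the Wilson Hessian not only
AT the background `V = U_A` but at every point `V_t = V e^{tX}` of the straight segment, applied to the segment's
own direction `X` (`f″(t) = hess (vary V X t) X X W`, `NE3HessForm.segment_derivData`).  By
`NE3HessBounds.hess_self_ge` at `V_t` this needs only two FIRST-ORDER stabilities: the plaquette radius of `V_t`
(road P2's `NE3EnergyVary.smallField_vary`, taken here as the hypothesis `SmallField (vary V X t) a'`) and the
dressed curl `d_{V_t} Y` versus `d_V Y` — proved here.  No second variation of `d_V` (`dcurlAt`) is differentiated.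

WHAT IS PROVED ([folklore]; operator norm; `V` unitary, `X` skew with `‖X(b)‖ ≤ α`, `δ := e^{|t|α} − 1`):
§1 elementary: `norm_mul_sub_mul_le` (`‖ab − a′b′‖ ≤ ‖a − a′‖ + ‖b − b′‖` for `‖a‖, ‖b′‖ ≤ 1`),
   `norm_vary_sub_le` (`‖V_t(b) − V(b)‖ ≤ δ`), `norm_Ad_sub_Ad_le` (`‖Ad_{u′}M − Ad_u M‖ ≤ 2‖u′ − u‖‖M‖`, unitary);
§2 **`norm_curlAt_vary_sub_le`**: `‖(d_{V_t} Y)(p′) − (d_V Y)(p′)‖ ≤ 6δ·Σ_{b⊂∂p′}‖Y(b)‖` (the three transport words of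
   `curlAt` have lengths 1, 2, 3, each letter moves by ≤ δ, unitary words do not amplify);
§3 `norm_sq_half_sub_le` and **`sum_curl_sq_vary_ge`**: `Σ_W ‖d_{V_t}Y‖² ≥ ½·Σ_W ‖d_V Y‖² − 144δ²·Σ_W bondSq Y`;
§4 **`hess_self_ge_vary`**: with `SmallField (vary V X t) a'`,
   `(½Σ_W‖d_V Y‖² − 144δ²Σ_W bondSq Y)∕N − 7a′·Σ_W bondSq Y ≤ hess (vary V X t) Y Y W` — the diagonal Hessian lower
   bound TRANSPORTED along the segment with explicit loss; for `Y = X ∈ T` and `TangentCoercive`-type Poincaré data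
   at `V` this is road P3's (E2) at every `t ∈ [0,1]` (`δ ≤ (e − 1)α` for `α ≤ 1`).

HONEST FRAMING.  Finite-T⁴ ultraviolet bookkeeping (rung (B)+1); matrix inequalities; no conditional of the cell; NOT
infinite volume, NOT a mass gap, NOT Clay, NOT summit progress.  ABSOLUTE RULE kept (no printed sentence is a
hypothesis; `SmallField (vary V X t) a'` is the tree's predicate, discharged by road P2's `smallField_vary`).
PLACEMENT: `Summits/QuantumFields/BalabanUV/`; imports this unit's `Support.NE3HessContinuity` and row NE3-R2's
`Support.AveragingDeficitPlaqDeriv` (for `vary_isUnitaryCfg`); moves nothing.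
-/

set_option autoImplicit false

open scoped BigOperators Matrix Matrix.Norms.L2Operator
open NormedSpace Finset

namespace Summit.QuantumFields.BalabanUV.T4Continuum.NE3CurlStability

open Literature.MathematicalPhysics.QuantumFieldTheory.Balaban1983to89
open B7Prop1Explicit B7Prop2Explicit MatrixLog UnitaryModel MatrixNorms
open T4AveragingDeficitWall hiding Site Plane Plaq Bond
open AveragingDeficitTransport (norm_Ad_of_unitary val_inv_eq_star_of_unitary mem_U1_of_unitary)
open AveragingDeficitPlaqDeriv (vary_isUnitaryCfg)
open NE3HessForm NE3HessBounds NE3HessContinuity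

noncomputable section

variable {d : ℕ} {n : Type*} [Fintype n] [DecidableEq n]

/-! ## §1 Elementary stabilities -/

/-- `‖ab − a′b′‖ ≤ ‖a − a′‖ + ‖b − b′‖` when `‖a‖ ≤ 1` and `‖b′‖ ≤ 1`. [folklore] -/
theorem norm_mul_sub_mul_le {a a' b b' : Matrix n n ℂ} (ha : ‖a‖ ≤ 1) (hb' : ‖b'‖ ≤ 1) :
    ‖a * b - a' * b'‖ ≤ ‖a - a'‖ + ‖b - b'‖ := by
  have h : a * b - a' * b' = a * (b - b') + (a - a') * b' := by noncomm_ring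
  rw [h]
  calc ‖a * (b - b') + (a - a') * b'‖ ≤ ‖a‖ * ‖b - b'‖ + ‖a - a'‖ * ‖b'‖ :=
        (norm_add_le _ _).trans (add_le_add (norm_mul_le _ _) (norm_mul_le _ _))
    _ ≤ 1 * ‖b - b'‖ + ‖a - a'‖ * 1 := by
        gcongr
    _ = ‖a - a'‖ + ‖b - b'‖ := by ring

/-- For unitary `V` and any `X`, `‖V_t(b) − V(b)‖ ≤ e^{‖tX(b)‖} − 1`. [folklore] -/
theorem norm_vary_sub_le [Nonempty n] {V : Site d → Fin d → (Matrix n n ℂ)ˣ} (hV : IsUnitaryCfg V) (X : Site d → Fin d → Matrix n n ℂ)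
    (t : ℝ) (x : Site d) (κ : Fin d) :
    ‖((vary V X t x κ : (Matrix n n ℂ)ˣ) : Matrix n n ℂ) - (V x κ : Matrix n n ℂ)‖ ≤ Real.exp ‖(t : ℂ) • X x κ‖ - 1 := by
  have hV1 : ‖((V x κ : (Matrix n n ℂ)ˣ) : Matrix n n ℂ)‖ ≤ 1 := (mem_U1_of_unitary (hV x κ)).1
  have hexp := (norm_exp_sub_one_le_of_norm_le (le_refl ‖(t : ℂ) • X x κ‖)).1
  have h : ((vary V X t x κ : (Matrix n n ℂ)ˣ) : Matrix n n ℂ) - (V x κ : Matrix n n ℂ) = (V x κ : Matrix n n ℂ) * (exp ((t : ℂ) • X x κ) - 1) := by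
    simp only [vary, Units.val_mul, val_expUnit]; noncomm_ring
  rw [h]
  calc ‖(V x κ : Matrix n n ℂ) * (exp ((t : ℂ) • X x κ) - 1)‖ ≤ ‖((V x κ : (Matrix n n ℂ)ˣ) : Matrix n n ℂ)‖ * ‖exp ((t : ℂ) • X x κ) - 1‖ :=
        norm_mul_le _ _
    _ ≤ 1 * (Real.exp ‖(t : ℂ) • X x κ‖ - 1) := by
        gcongr
    _ = Real.exp ‖(t : ℂ) • X x κ‖ - 1 := one_mul _

/-- The sup form: `‖V_t(b) − V(b)‖ ≤ e^{|t|α} − 1` when `‖X(b)‖ ≤ α`. [folklore] -/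
theorem norm_vary_sub_le_of_sup [Nonempty n] {V : Site d → Fin d → (Matrix n n ℂ)ˣ} (hV : IsUnitaryCfg V)
    {X : Site d → Fin d → Matrix n n ℂ} {α : ℝ} (hXα : ∀ x κ, ‖X x κ‖ ≤ α) (t : ℝ) (x : Site d) (κ : Fin d) :
    ‖((vary V X t x κ : (Matrix n n ℂ)ˣ) : Matrix n n ℂ) - (V x κ : Matrix n n ℂ)‖ ≤ Real.exp (|t| * α) - 1 := by
  refine (norm_vary_sub_le hV X t x κ).trans ?_
  have : ‖(t : ℂ) • X x κ‖ ≤ |t| * α := by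
    rw [norm_smul, Complex.norm_real, Real.norm_eq_abs]
    exact mul_le_mul_of_nonneg_left (hXα x κ) (abs_nonneg t)
  linarith [Real.exp_le_exp.mpr this]

/-- `‖Ad_{u′} M − Ad_u M‖ ≤ 2‖u′ − u‖·‖M‖` for unitary `u, u′`. [folklore] -/
theorem norm_Ad_sub_Ad_le [Nonempty n] {u u' : (Matrix n n ℂ)ˣ} (hu : u ∈ unitaryUnits (Matrix n n ℂ)) (hu' : u' ∈ unitaryUnits (Matrix n n ℂ)) (M : Matrix n n ℂ) :
    ‖Ad u' M - Ad u M‖ ≤ 2 * ‖(u' : Matrix n n ℂ) - (u : Matrix n n ℂ)‖ * ‖M‖ := by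
  have hU : ‖((u : (Matrix n n ℂ)ˣ) : Matrix n n ℂ)‖ ≤ 1 := (mem_U1_of_unitary hu).1
  have hUi' : ‖((u'⁻¹ : (Matrix n n ℂ)ˣ) : Matrix n n ℂ)‖ ≤ 1 := (mem_U1_of_unitary hu').2
  have hinv : ‖((u'⁻¹ : (Matrix n n ℂ)ˣ) : Matrix n n ℂ) - ((u⁻¹ : (Matrix n n ℂ)ˣ) : Matrix n n ℂ)‖ = ‖(u' : Matrix n n ℂ) - (u : Matrix n n ℂ)‖ := by
    rw [val_inv_eq_star_of_unitary hu, val_inv_eq_star_of_unitary hu', ← star_sub, norm_star]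
  have h : Ad u' M - Ad u M
      = ((u' : Matrix n n ℂ) - (u : Matrix n n ℂ)) * M * ((u'⁻¹ : (Matrix n n ℂ)ˣ) : Matrix n n ℂ) + (u : Matrix n n ℂ) * M * (((u'⁻¹ : (Matrix n n ℂ)ˣ) : Matrix n n ℂ) - ((u⁻¹ : (Matrix n n ℂ)ˣ) : Matrix n n ℂ)) := by
    unfold Ad; noncomm_ring
  rw [h]
  calc ‖((u' : Matrix n n ℂ) - (u : Matrix n n ℂ)) * M * ((u'⁻¹ : (Matrix n n ℂ)ˣ) : Matrix n n ℂ) + (u : Matrix n n ℂ) * M * (((u'⁻¹ : (Matrix n n ℂ)ˣ) : Matrix n n ℂ) - ((u⁻¹ : (Matrix n n ℂ)ˣ) : Matrix n n ℂ))‖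
      ≤ ‖(u' : Matrix n n ℂ) - (u : Matrix n n ℂ)‖ * ‖M‖ * ‖((u'⁻¹ : (Matrix n n ℂ)ˣ) : Matrix n n ℂ)‖ + ‖((u : (Matrix n n ℂ)ˣ) : Matrix n n ℂ)‖ * ‖M‖ * ‖((u'⁻¹ : (Matrix n n ℂ)ˣ) : Matrix n n ℂ) - ((u⁻¹ : (Matrix n n ℂ)ˣ) : Matrix n n ℂ)‖ := by
        refine (norm_add_le _ _).trans (add_le_add ?_ ?_)
        · exact (norm_mul_le _ _).trans (mul_le_mul_of_nonneg_right (norm_mul_le _ _) (norm_nonneg _))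
        · exact (norm_mul_le _ _).trans (mul_le_mul_of_nonneg_right (norm_mul_le _ _) (norm_nonneg _))
    _ ≤ ‖(u' : Matrix n n ℂ) - (u : Matrix n n ℂ)‖ * ‖M‖ * 1 + 1 * ‖M‖ * ‖(u' : Matrix n n ℂ) - (u : Matrix n n ℂ)‖ := by
        rw [hinv]; gcongr
    _ = 2 * ‖(u' : Matrix n n ℂ) - (u : Matrix n n ℂ)‖ * ‖M‖ := by ring

/-! ## §2 The dressed curl along the segment -/

/-- **`‖(d_{V e^{tX}} Y)(p′) − (d_V Y)(p′)‖ ≤ 6(e^{|t|α} − 1)·Σ_{b⊂∂p′}‖Y(b)‖`** for unitary `V`, skew `X` with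
`‖X(b)‖ ≤ α`. [folklore] -/
theorem norm_curlAt_vary_sub_le [Nonempty n] {V : Site d → Fin d → (Matrix n n ℂ)ˣ} (hV : IsUnitaryCfg V)
    {X : Site d → Fin d → Matrix n n ℂ} (hX : IsSkewDir X) {α : ℝ} (hXα : ∀ x κ, ‖X x κ‖ ≤ α) (t : ℝ)
    (Y : Site d → Fin d → Matrix n n ℂ) (z : Site d) (μ ν : Fin d) :
    ‖curlAt (vary V X t) Y z μ ν - curlAt V Y z μ ν‖ ≤ 6 * (Real.exp (|t| * α) - 1) * bondL1At Y z μ ν := by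
  set V' := vary V X t with hV'
  have hVu' : IsUnitaryCfg V' := vary_isUnitaryCfg hV hX t
  set δ := Real.exp (|t| * α) - 1 with hδ
  have hδ0 : 0 ≤ δ := by
    have : 0 ≤ |t| * α := mul_nonneg (abs_nonneg t) ((norm_nonneg _).trans (hXα z μ))
    have := Real.one_le_exp this
    linarith
  -- letters
  have hl : ∀ x κ, ‖((V' x κ : (Matrix n n ℂ)ˣ) : Matrix n n ℂ) - (V x κ : Matrix n n ℂ)‖ ≤ δ := fun x κ => norm_vary_sub_le_of_sup hV hXα t x κ
  have hn1 : ∀ x κ, ‖((V' x κ : (Matrix n n ℂ)ˣ) : Matrix n n ℂ)‖ ≤ 1 := fun x κ => (mem_U1_of_unitary (hVu' x κ)).1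
  have hn0 : ∀ x κ, ‖((V x κ : (Matrix n n ℂ)ˣ) : Matrix n n ℂ)‖ ≤ 1 := fun x κ => (mem_U1_of_unitary (hV x κ)).1
  have hn0i : ∀ x κ, ‖(((V x κ)⁻¹ : (Matrix n n ℂ)ˣ) : Matrix n n ℂ)‖ ≤ 1 := fun x κ => (mem_U1_of_unitary (hV x κ)).2
  have hli : ∀ x κ, ‖(((V' x κ)⁻¹ : (Matrix n n ℂ)ˣ) : Matrix n n ℂ) - (((V x κ)⁻¹ : (Matrix n n ℂ)ˣ) : Matrix n n ℂ)‖ ≤ δ := fun x κ => by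
    rw [val_inv_eq_star_of_unitary (hV x κ), val_inv_eq_star_of_unitary (hVu' x κ), ← star_sub, norm_star]
    exact hl x κ
  -- the three words
  have hw1 : ‖((V' z μ : (Matrix n n ℂ)ˣ) : Matrix n n ℂ) - (V z μ : Matrix n n ℂ)‖ ≤ δ := hl z μ
  have hw2 : ‖((V' z μ * V' (z + e μ) ν : (Matrix n n ℂ)ˣ) : Matrix n n ℂ) - ((V z μ * V (z + e μ) ν : (Matrix n n ℂ)ˣ) : Matrix n n ℂ)‖ ≤ 2 * δ := by
    rw [Units.val_mul, Units.val_mul]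
    have h := (norm_mul_sub_mul_le (hn1 z μ) (hn0 (z + e μ) ν) :
      ‖((V' z μ : (Matrix n n ℂ)ˣ) : Matrix n n ℂ) * ((V' (z + e μ) ν : (Matrix n n ℂ)ˣ) : Matrix n n ℂ) - (V z μ : Matrix n n ℂ) * ((V (z + e μ) ν : (Matrix n n ℂ)ˣ) : Matrix n n ℂ)‖ ≤ _)
    linarith [hl z μ, hl (z + e μ) ν]
  have hw3 : ‖((V' z μ * V' (z + e μ) ν * (V' (z + e ν) μ)⁻¹ : (Matrix n n ℂ)ˣ) : Matrix n n ℂ)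
      - ((V z μ * V (z + e μ) ν * (V (z + e ν) μ)⁻¹ : (Matrix n n ℂ)ˣ) : Matrix n n ℂ)‖ ≤ 3 * δ := by
    have hn12 : ‖((V' z μ * V' (z + e μ) ν : (Matrix n n ℂ)ˣ) : Matrix n n ℂ)‖ ≤ 1 :=
      (mem_U1_of_unitary ((unitaryUnits (Matrix n n ℂ)).mul_mem (hVu' z μ) (hVu' (z + e μ) ν))).1
    rw [Units.val_mul (V' z μ * V' (z + e μ) ν), Units.val_mul (V z μ * V (z + e μ) ν)]
    have h := (norm_mul_sub_mul_le hn12 (hn0i (z + e ν) μ) :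
      ‖((V' z μ * V' (z + e μ) ν : (Matrix n n ℂ)ˣ) : Matrix n n ℂ) * (((V' (z + e ν) μ)⁻¹ : (Matrix n n ℂ)ˣ) : Matrix n n ℂ)
        - ((V z μ * V (z + e μ) ν : (Matrix n n ℂ)ˣ) : Matrix n n ℂ) * (((V (z + e ν) μ)⁻¹ : (Matrix n n ℂ)ˣ) : Matrix n n ℂ)‖ ≤ _)
    linarith [hw2, hli (z + e ν) μ]
  -- unitarity of the words
  have hu1 : V z μ ∈ unitaryUnits (Matrix n n ℂ) := hV z μ
  have hu1' : V' z μ ∈ unitaryUnits (Matrix n n ℂ) := hVu' z μ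
  have hu2 : V z μ * V (z + e μ) ν ∈ unitaryUnits (Matrix n n ℂ) := (unitaryUnits (Matrix n n ℂ)).mul_mem (hV z μ) (hV (z + e μ) ν)
  have hu2' : V' z μ * V' (z + e μ) ν ∈ unitaryUnits (Matrix n n ℂ) := (unitaryUnits (Matrix n n ℂ)).mul_mem (hVu' z μ) (hVu' (z + e μ) ν)
  have hu3 : V z μ * V (z + e μ) ν * (V (z + e ν) μ)⁻¹ ∈ unitaryUnits (Matrix n n ℂ) :=
    (unitaryUnits (Matrix n n ℂ)).mul_mem hu2 ((unitaryUnits (Matrix n n ℂ)).inv_mem (hV (z + e ν) μ))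
  have hu3' : V' z μ * V' (z + e μ) ν * (V' (z + e ν) μ)⁻¹ ∈ unitaryUnits (Matrix n n ℂ) :=
    (unitaryUnits (Matrix n n ℂ)).mul_mem hu2' ((unitaryUnits (Matrix n n ℂ)).inv_mem (hVu' (z + e ν) μ))
  -- the four Ad differences
  have hA1 := norm_Ad_sub_Ad_le hu1 hu1' (Y z μ)
  have hA2 := norm_Ad_sub_Ad_le hu2 hu2' (Y (z + e μ) ν)
  have hA3 := norm_Ad_sub_Ad_le hu2 hu2' (Y (z + e ν) μ)
  have hA4 := norm_Ad_sub_Ad_le hu3 hu3' (Y z ν)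
  have hsplit : curlAt V' Y z μ ν - curlAt V Y z μ ν
      = (Ad (V' z μ) (Y z μ) - Ad (V z μ) (Y z μ))
        + (Ad (V' z μ * V' (z + e μ) ν) (Y (z + e μ) ν) - Ad (V z μ * V (z + e μ) ν) (Y (z + e μ) ν))
        - (Ad (V' z μ * V' (z + e μ) ν) (Y (z + e ν) μ) - Ad (V z μ * V (z + e μ) ν) (Y (z + e ν) μ))
        - (Ad (V' z μ * V' (z + e μ) ν * (V' (z + e ν) μ)⁻¹) (Y z ν)
            - Ad (V z μ * V (z + e μ) ν * (V (z + e ν) μ)⁻¹) (Y z ν)) := by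
    simp only [T4AveragingDeficitWall.curlAt]; abel
  rw [hsplit]
  have hY1 := norm_nonneg (Y z μ)
  have hY2 := norm_nonneg (Y (z + e μ) ν)
  have hY3 := norm_nonneg (Y (z + e ν) μ)
  have hY4 := norm_nonneg (Y z ν)
  calc _ ≤ ‖Ad (V' z μ) (Y z μ) - Ad (V z μ) (Y z μ)‖
        + ‖Ad (V' z μ * V' (z + e μ) ν) (Y (z + e μ) ν) - Ad (V z μ * V (z + e μ) ν) (Y (z + e μ) ν)‖
        + ‖Ad (V' z μ * V' (z + e μ) ν) (Y (z + e ν) μ) - Ad (V z μ * V (z + e μ) ν) (Y (z + e ν) μ)‖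
        + ‖Ad (V' z μ * V' (z + e μ) ν * (V' (z + e ν) μ)⁻¹) (Y z ν)
            - Ad (V z μ * V (z + e μ) ν * (V (z + e ν) μ)⁻¹) (Y z ν)‖ := by
        refine (norm_sub_le _ _).trans (add_le_add ((norm_sub_le _ _).trans (add_le_add
          ((norm_add_le _ _).trans le_rfl) le_rfl)) le_rfl)
    _ ≤ 2 * δ * ‖Y z μ‖ + 2 * (2 * δ) * ‖Y (z + e μ) ν‖ + 2 * (2 * δ) * ‖Y (z + e ν) μ‖
        + 2 * (3 * δ) * ‖Y z ν‖ := by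
        gcongr
        · exact hA1.trans (by gcongr)
        · exact hA2.trans (by gcongr)
        · exact hA3.trans (by gcongr)
        · exact hA4.trans (by gcongr)
    _ ≤ 6 * δ * bondL1At Y z μ ν := by
        unfold bondL1At; nlinarith

/-- Indexed-plaquette form. [folklore] -/
theorem norm_curl_vary_sub_le [Nonempty n] {V : Site d → Fin d → (Matrix n n ℂ)ˣ} (hV : IsUnitaryCfg V)
    {X : Site d → Fin d → Matrix n n ℂ} (hX : IsSkewDir X) {α : ℝ} (hXα : ∀ x κ, ‖X x κ‖ ≤ α) (t : ℝ)
    (Y : Site d → Fin d → Matrix n n ℂ) (p : T4AveragingDeficitWall.Plaq d) :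
    ‖curl (vary V X t) Y p - curl V Y p‖ ≤ 6 * (Real.exp (|t| * α) - 1) * bondL1 Y p :=
  norm_curlAt_vary_sub_le hV hX hXα t Y p.1 p.2.1.1 p.2.1.2

/-! ## §3 Squares and sums -/

/-- If `‖c‖ ≤ ‖c′‖ + m` then `‖c‖²∕2 − m² ≤ ‖c′‖²`. [folklore] -/
theorem norm_sq_half_sub_le {c c' : Matrix n n ℂ} {m : ℝ} (h : ‖c‖ ≤ ‖c'‖ + m) :
    ‖c‖ ^ 2 / 2 - m ^ 2 ≤ ‖c'‖ ^ 2 := by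
  have h0 := norm_nonneg c
  have h1 := norm_nonneg c'
  nlinarith [sq_nonneg (‖c'‖ - m)]

/-- **`Σ_W ‖d_{V_t}Y‖² ≥ ½Σ_W ‖d_V Y‖² − 144(e^{|t|α} − 1)²·Σ_W bondSq Y`.** [folklore] -/
theorem sum_curl_sq_vary_ge [Nonempty n] {V : Site d → Fin d → (Matrix n n ℂ)ˣ} (hV : IsUnitaryCfg V)
    {X : Site d → Fin d → Matrix n n ℂ} (hX : IsSkewDir X) {α : ℝ} (hXα : ∀ x κ, ‖X x κ‖ ≤ α) (t : ℝ)
    (Y : Site d → Fin d → Matrix n n ℂ) (W : Finset (T4AveragingDeficitWall.Plaq d)) :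
    (∑ p ∈ W, ‖curl V Y p‖ ^ 2) / 2 - 144 * (Real.exp (|t| * α) - 1) ^ 2 * ∑ p ∈ W, bondSq Y p
      ≤ ∑ p ∈ W, ‖curl (vary V X t) Y p‖ ^ 2 := by
  rw [Finset.sum_div, Finset.mul_sum, ← Finset.sum_sub_distrib]
  refine Finset.sum_le_sum fun p _ => ?_
  set δ := Real.exp (|t| * α) - 1
  have hδ0 : 0 ≤ δ := by
    have : 0 ≤ |t| * α := mul_nonneg (abs_nonneg t) ((norm_nonneg _).trans (hXα p.1 p.2.1.1))
    have := Real.one_le_exp this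
    simp only [δ]; linarith
  have hd := norm_curl_vary_sub_le hV hX hXα t Y p
  have hL0 := bondL1At_nonneg Y p.1 p.2.1.1 p.2.1.2
  have hm : ‖curl V Y p‖ ≤ ‖curl (vary V X t) Y p‖ + 6 * δ * bondL1 Y p := by
    have h' : ‖curl V Y p - curl (vary V X t) Y p‖ ≤ 6 * δ * bondL1 Y p := by rw [norm_sub_rev]; exact hd
    linarith [norm_le_insert' (curl V Y p) (curl (vary V X t) Y p)]
  have hsq := norm_sq_half_sub_le hm
  have hL2 : bondL1 Y p ^ 2 ≤ 4 * bondSq Y p := bondL1At_sq_le Y p.1 p.2.1.1 p.2.1.2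
  have hmm : (6 * δ * bondL1 Y p) ^ 2 ≤ 144 * δ ^ 2 * bondSq Y p := by nlinarith [sq_nonneg δ]
  linarith

/-! ## §4 The diagonal Hessian lower bound transported along the segment -/

/-- **THE DIAGONAL HESSIAN LOWER BOUND AT `V e^{tX}` IN TERMS OF DATA AT `V`**: for unitary `V`, skew `X` with
`‖X(b)‖ ≤ α`, skew `Y`, and `SmallField (vary V X t) a′` (road P2's `smallField_vary` supplies
`a′ = a + 4(e^{α|t|} − 1)` from `SmallField V a`),
`(½Σ_W‖d_V Y‖² − 144(e^{|t|α} − 1)²Σ_W bondSq Y)∕N − 7a′Σ_W bondSq Y ≤ hess (vary V X t) Y Y W`. [folklore] -/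
theorem hess_self_ge_vary [Nonempty n] {V : Site d → Fin d → (Matrix n n ℂ)ˣ} (hV : IsUnitaryCfg V)
    {X : Site d → Fin d → Matrix n n ℂ} (hX : IsSkewDir X) {α : ℝ} (hXα : ∀ x κ, ‖X x κ‖ ≤ α) (t : ℝ)
    {Y : Site d → Fin d → Matrix n n ℂ} (hY : IsSkewDir Y) {a' : ℝ} (hVa' : SmallField (vary V X t) a')
    (W : Finset (T4AveragingDeficitWall.Plaq d)) :
    ((∑ p ∈ W, ‖curl V Y p‖ ^ 2) / 2 - 144 * (Real.exp (|t| * α) - 1) ^ 2 * ∑ p ∈ W, bondSq Y p)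
        / (Fintype.card n : ℝ) - 7 * a' * ∑ p ∈ W, bondSq Y p
      ≤ hess (vary V X t) Y Y W := by
  have h1 := hess_self_ge (vary_isUnitaryCfg hV hX t) hY hVa' W
  have h2 := sum_curl_sq_vary_ge hV hX hXα t Y W
  have hN : (0 : ℝ) < Fintype.card n := Nat.cast_pos.mpr Fintype.card_pos
  have h3 := div_le_div_of_nonneg_right h2 hN.le
  linarith

end

end Summit.QuantumFields.BalabanUV.T4Continuum.NE3CurlStability
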